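import Mathlib.FieldTheory.PurelyInseparable.Basic
import HarnessLib

/-!
# Stub `stub_generator` for crux stmt-ResolutionOfSingularities-15917 (`RadicialJung.CleanModels`)

A generator of a purely inseparable extension of prime degree: if `L/K` is purely inseparable
with `[L : K] = p` prime and `char K = p`, then every `y ∈ L` has `y^p ∈ K`, and some
`y₀ ∈ L ∖ K` has `y₀^p = g₀ ∈ K` with `g₀` not a `p`-th power in `K`.

Proof: `minpoly K y = X^(p^n) - C a` (`IsPurelyInseparable.minpoly_eq_X_pow_sub_C`) has degree
`p^n ≤ [L : K] = p`, so `n ≤ 1` and `y^p ∈ K`. Since `[L : K] = p ≠ 1` the algebra map is not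
surjective, giving `y₀ ∉ K`; if `c^p = g₀ = y₀^p` then `y₀ = c` by injectivity of Frobenius on
the field `L` of characteristic `p`.
-/

set_option linter.dupNamespace false

namespace Summit.ResolutionOfSingularities.ResolutionOfSingularities.Theorems.RadicialJung.CleanModels

open Polynomial

/-- In a purely inseparable extension `L/K` of prime degree `p = char K`, every `y ∈ L` has
`y ^ p ∈ K`. -/
theorem exists_algebraMap_eq_pow_of_finrank_eq {K L : Type*} [Field K] [Field L] [Algebra K L]
    (p : ℕ) (hp : p.Prime) [CharP K p] [IsPurelyInseparable K L]
    (hdeg : Module.finrank K L = p) (y : L) : ∃ x : K, algebraMap K L x = y ^ p := by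
  haveI : ExpChar K p := ExpChar.prime hp
  haveI : FiniteDimensional K L := Module.finite_of_finrank_pos (by rw [hdeg]; exact hp.pos)
  obtain ⟨n, a, hmin⟩ := IsPurelyInseparable.minpoly_eq_X_pow_sub_C K p y
  have hdegle : (minpoly K y).natDegree ≤ p := hdeg ▸ minpoly.natDegree_le y
  rw [hmin, natDegree_X_pow_sub_C] at hdegle
  have hn : n ≤ 1 := (Nat.pow_le_pow_iff_right hp.one_lt).1 (by rw [pow_one]; exact hdegle)
  have hy : y ^ p ^ n = algebraMap K L a := by
    have h := minpoly.aeval K y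
    rw [hmin, map_sub, aeval_X_pow, aeval_C, sub_eq_zero] at h
    exact h
  interval_cases n
  · rw [pow_zero, pow_one] at hy
    exact ⟨a ^ p, by rw [map_pow, hy]⟩
  · rw [pow_one] at hy
    exact ⟨a, hy.symm⟩

/-- **A generator of a purely inseparable extension of prime degree.** If `L/K` is purely
inseparable with `[L : K] = p` prime (`char K = p`), then every `y ∈ L` has `y^p ∈ K`, and some
`y₀ ∈ L ∖ K` has `y₀^p = g₀ ∈ K` with `g₀` not a `p`-th power in `K`. -/
theorem stub_generator {K L : Type*} [Field K] [Field L] [Algebra K L] (p : ℕ) (hp : p.Prime)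
    [CharP K p] [IsPurelyInseparable K L] (hdeg : Module.finrank K L = p) :
    (∀ y : L, ∃ x : K, algebraMap K L x = y ^ p) ∧
      ∃ (y₀ : L) (g₀ : K), y₀ ∉ Set.range (algebraMap K L) ∧ algebraMap K L g₀ = y₀ ^ p ∧
        ∀ c : K, c ^ p ≠ g₀ := by
  have h1 := exists_algebraMap_eq_pow_of_finrank_eq p hp hdeg
  refine ⟨h1, ?_⟩
  haveI : CharP L p := charP_of_injective_algebraMap (algebraMap K L).injective p
  haveI : ExpChar L p := ExpChar.prime hp
  -- the algebra map is not surjective since `[L : K] = p ≠ 1`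
  have hns : ¬ Function.Surjective (algebraMap K L) := fun hsurj =>
    hp.one_lt.ne' (hdeg.symm.trans
      (Module.finrank_of_bijective_algebraMap ⟨(algebraMap K L).injective, hsurj⟩))
  obtain ⟨y₀, hy₀⟩ := not_forall.mp hns
  obtain ⟨g₀, hg₀⟩ := h1 y₀
  refine ⟨y₀, g₀, fun ⟨x, hx⟩ => hy₀ ⟨x, hx⟩, hg₀, fun c hc => hy₀ ⟨c, ?_⟩⟩
  -- `c ^ p = g₀` forces `algebraMap K L c = y₀` by injectivity of Frobenius
  apply frobenius_inj L p
  rw [frobenius_def, frobenius_def, ← map_pow, hc, hg₀]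

end Summit.ResolutionOfSingularities.ResolutionOfSingularities.Theorems.RadicialJung.CleanModels
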